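import Summits.HodgeConjecture.HodgeConjecture.Theorems.Ring2AbelianAllAndreThreeEigenlines
import HarnessLib

/-!
# Ring 2 · sub-cell AbelianAll (ALL ABELIAN VARIETIES), André axis, part XLI-f — ONE WEIL-BLOCK ENTRY SUFFICES FOR A REAL CYCLE: the
# conjugation step of parts XLI-d/e in the kernel (modulo a displayed conjugation on the fibre commuting with the fibre trace)

HONEST FRAMING (page 1, verbatim): **research route, not a corollary; conditional on HC_CM plus one named
minimal statement.** Cell line: research route conditional on HC_CM; not a corollary; Q11.4-sentence-2
already refuted in dim ≥ 3. Nothing in this file proves a case of the Hodge conjecture for an abelian variety, nor `B(X)` for a new `X`;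
`HC_CM` (`Theses.RankFourFaces.CMAbelianHodge`) does not occur in this file; item `Theses.RankFourFaces.CMToAbelian` (stmt-16267)
OPEN and not closed here. Seat `pub-hodge-ring2-ab-andre-2`, gen 33; brief (iii) "state the smallest open instance as a find-the-cycle
problem".

Part XLI-e: with three eigenlines `x_a, x_b, x_c` of an `S`-endomorphism on the invariant classes of a fibre, β holds as soon as algebraic cycles
have fibre traces with non-zero `(a,a)`+`(b,b)`+`(c,c)` or `(a,a)`+`(b,c)`+`(c,b)` entries, the `a`-slot being free (one exterior product). THIS FILE
proves the symmetry that halves the Weil slots: if a conjugate-linear map `cj` of `H^{k+2}(X_t)` (in the habitat: complex conjugation of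
`H^{k+2}(X_t; ℂ) = H^{k+2}(X_t; ℝ) ⊗ ℂ`) is an involution commuting with `φ_t^*` and with the fibre trace `v_M = j_t^* M j_{t*}` of `M` (true for a cycle
with REAL class — `j_t^*`, `j_{t*}` and `[M]_*` are real), exchanges the eigenlines (`cj x_b = x_c`) and conjugates the eigenvalues (`conj b = c`,
`conj a = a`), then `cj` intertwines the Lagrange idempotents `L_b`, `L_c` (**`conj_lagrange`**), so **the `(c,b)` entry is the conjugate of the
`(b,c)` entry and the `(c,c)` entry the conjugate of the `(b,b)` entry** (**`lagrange_entry_conj_swap`**, **`lagrange_entry_conj_diag`**). Hence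
(**`exists_betaInverse_of_weilBlock_oneEntry`**): the `a`-slot (`u, u'` algebraic, `∫ j^*u ∪ j^*u' ≠ 0`) plus ONE algebraic `M` with ONE non-zero
Weil-block entry (`L_b v_M x_c ≠ 0` or `L_b v_M x_b ≠ 0`) give β at `t` in degree `k + 2`. W₆ READING (hypotheses print-true, not formalised):
`B⋆(𝒳) ∀η` for a CM-power-pointed pencil of Weil-type abelian sixfolds holds as soon as ONE algebraic cycle on the 14-fold `𝒳 × 𝒳` with real
class has a fibre trace that does not carry the Weil plane `W_t` of one fibre into `ℂθ³` — the weakest form of the open instance reached on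
this axis.

## What is proved (theorems only; no definition, no named fact, no sorry; standard axioms)

`conj_lagrange`, `lagrange_entry_conj_swap`, `lagrange_entry_conj_diag`, **`exists_betaInverse_of_weilBlock_oneEntry`**,
**`exists_betaInverse_of_weilBlock_oneEntry_diag`**.

HONEST STATUS. Elementary; not located in print; claimed only as a formal object. The conjugation `cj` and its commutation with the fibre
trace are HYPOTHESES (the tree's `conjClass` is natural for pull-backs; its compatibility with the Gysin map and with correspondence actions
of real classes is not formalised here). GAP: none closed; N104 untouched.
References: Kleiman1968AlgebraicCycles (2A11); VoisinHodgeI2002 (§6.1.3 Cor. 6.12); vanGeemen1994HodgeAV (4.3, 5.4); Tankeev2003 (10.1, 11.6).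
-/

noncomputable section

set_option linter.dupNamespace false

namespace Summit.HodgeConjecture.HodgeConjecture.Ring2.AbelianAll

open CategoryTheory CategoryTheory.Limits AlgebraicGeometry
open Literature.AlgebraicGeometry Literature.AlgebraicGeometry.Motives
open Literature.AlgebraicGeometry.HodgeTheory
open Literature.AlgebraicTopology.SingularHomology (singularCohomology cupProduct)
open Summit.HodgeConjecture.HodgeConjecture.Theorems (deg_fiberGysin_aux)

/-! ## §1 A conjugation intertwines the Lagrange idempotents of conjugate eigenvalues -/

section Conj

variable {V : Type*} [AddCommGroup V] [Module ℂ V]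

/-- **`cj ∘ L_b = L_c ∘ cj`** for a conjugate-linear `cj` commuting with `T`, when `conj a = a`, `conj b = c`, `conj c = b`:
`L_b = ((b−a)(b−c))⁻¹(T² − (a+c)T + ac)` has conjugate coefficients `((c−a)(c−b))⁻¹`, `a+b`, `ab`. [cite: VoisinHodgeI2002, §6.1.3 Cor. 6.12] [folklore] -/
theorem conj_lagrange (cj : V →ₛₗ[starRingEnd ℂ] V) (T : V →ₗ[ℂ] V) (hcT : ∀ x, cj (T x) = T (cj x)) {a b c : ℂ}
    (ha : starRingEnd ℂ a = a) (hb : starRingEnd ℂ b = c) (hc : starRingEnd ℂ c = b) (y : V) :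
    cj ((((b - a) * (b - c))⁻¹ • (T ∘ₗ T - (a + c) • T + (a * c) • LinearMap.id) : V →ₗ[ℂ] V) y) =
      (((c - a) * (c - b))⁻¹ • (T ∘ₗ T - (a + b) • T + (a * b) • LinearMap.id) : V →ₗ[ℂ] V) (cj y) := by
  simp only [LinearMap.smul_apply, LinearMap.add_apply, LinearMap.sub_apply, LinearMap.comp_apply, LinearMap.id_apply, LinearMap.map_smulₛₗ,
    map_add, map_sub, hcT, map_inv₀, map_mul, ha, hb, hc]

/-- **Anti-diagonal entries are conjugate**: with `cj` as above also commuting with `v` and `cj x_b = x_c` (`cj` an involution),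
`L_c (v x_b) = cj (L_b (v x_c))`; in particular one vanishes iff the other does. [cite: VoisinHodgeI2002, §6.1.3 Cor. 6.12] [folklore] -/
theorem lagrange_entry_conj_swap (cj : V →ₛₗ[starRingEnd ℂ] V) (hcc : ∀ x, cj (cj x) = x) (T v : V →ₗ[ℂ] V)
    (hcT : ∀ x, cj (T x) = T (cj x)) (hcv : ∀ x, cj (v x) = v (cj x)) {a b c : ℂ}
    (ha : starRingEnd ℂ a = a) (hb : starRingEnd ℂ b = c) (hc : starRingEnd ℂ c = b) {xb xc : V} (hx : cj xb = xc) :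
    (((c - a) * (c - b))⁻¹ • (T ∘ₗ T - (a + b) • T + (a * b) • LinearMap.id) : V →ₗ[ℂ] V) (v xb) =
      cj (((((b - a) * (b - c))⁻¹ • (T ∘ₗ T - (a + c) • T + (a * c) • LinearMap.id) : V →ₗ[ℂ] V) (v xc))) := by
  rw [conj_lagrange cj T hcT ha hb hc, hcv, ← hx, hcc]

/-- **Diagonal Weil entries are conjugate**: `L_c (v x_c) = cj (L_b (v x_b))`. [cite: VoisinHodgeI2002, §6.1.3 Cor. 6.12] [folklore] -/
theorem lagrange_entry_conj_diag (cj : V →ₛₗ[starRingEnd ℂ] V) (T v : V →ₗ[ℂ] V)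
    (hcT : ∀ x, cj (T x) = T (cj x)) (hcv : ∀ x, cj (v x) = v (cj x)) {a b c : ℂ}
    (ha : starRingEnd ℂ a = a) (hb : starRingEnd ℂ b = c) (hc : starRingEnd ℂ c = b) {xb xc : V} (hx : cj xb = xc) :
    (((c - a) * (c - b))⁻¹ • (T ∘ₗ T - (a + b) • T + (a * b) • LinearMap.id) : V →ₗ[ℂ] V) (v xc) =
      cj (((((b - a) * (b - c))⁻¹ • (T ∘ₗ T - (a + c) • T + (a * c) • LinearMap.id) : V →ₗ[ℂ] V) (v xb))) := by
  rw [conj_lagrange cj T hcT ha hb hc, hcv, hx]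

end Conj

variable {𝒳 S : SchemeOver ℂ} {d : ℕ} {f : 𝒳 ⟶ S} (hf : IsCompactAbelianPencil f d)

/-- `𝐆[hf, s, k]` — `j_{s*} : Hᵏ(X_s(ℂ); ℂ) → H^{k+2}(𝒳(ℂ); ℂ)` for the complex orientations (display notation, as in part XL-a).
[cite: FultonYoungTableaux1997, Appendix B §B.1 (5)] -/
local notation3 (prettyPrint := false) "𝐆[" hf ", " s ", " k "]" =>
  complexGysin complexOrientationFamily (IsCompactAbelianPencil.isSmoothProjective_fiberOver hf s)
    (IsCompactAbelianPencil.isSmoothProjective_total hf) (fiberι f s) (deg_fiberGysin_aux k d)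

/-- `𝐣[s, k]` — `j_s^* : Hᵏ(𝒳(ℂ); ℂ) → Hᵏ(X_s(ℂ); ℂ)` as a linear map (display notation). [cite: VoisinHodgeI2002, §7.3.2] -/
local notation3 (prettyPrint := false) "𝐣[" s ", " k "]" => (complexBetti.map (fiberι f s) k).hom

/-- `𝐋[T ; a ; b, c]` — the Lagrange idempotent `((a−b)(a−c))⁻¹ (T∘T − (b+c)T + bc·𝟙)` of `a` among `{a, b, c}` (display notation, as in part XLI-e).
[cite: DeningerMurre1991, Thm. 3.1] -/
local notation3 (prettyPrint := false) "𝐋[" T " ; " a " ; " b ", " c "]" =>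
  ((((a - b) * (a - c))⁻¹ : ℂ) • (T ∘ₗ T - (b + c) • T + (b * c) • LinearMap.id) : _ →ₗ[ℂ] _)

/-! ## §2 One Weil-block entry of one real cycle -/

section OneEntry

/-- **ONE NON-ZERO ANTI-DIAGONAL WEIL ENTRY OF ONE REAL CYCLE SUFFICES.** Setting of part XLI-e (`S`-endomorphism `φ`, eigenlines `x_a = j_t^* u`,
`x_b`, `x_c` with distinct eigenvalues spanning `j_t^* H^{2q+2}(𝒳)`, algebraic `u ∈ N^{q+1}(𝒳)`, `u' ∈ N^{p'}(𝒳)` with `∫ j^*u ∪ j^*u' ≠ 0`) plus a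
conjugate-linear involution `cj` of `H^{2q+2}(X_t)` commuting with `φ_t^*` and with the fibre trace of the algebraic `M`, with `cj x_b = x_c`, `conj a = a`,
`conj b = c`, `conj c = b`. If the `(b,c)` entry `L_b (j_t^* M j_{t*} x_c)` is non-zero then β holds at `t` in degree `2q+2` (the `(c,b)` entry is its
conjugate; part XLI-e's swap pattern with `M_b = M_c = M`). W₆: one algebraic cycle with real class on the 14-fold whose fibre trace moves `W_σ̄`
off `ℂθ³ ⊕ W_σ̄`… precisely `L_σ v_M x_σ̄ ≠ 0`. [cite: Kleiman1968AlgebraicCycles, Appendix to §2, Thm. 2A11] [cite: VoisinHodgeI2002, §6.1.3 Cor. 6.12]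
[cite: vanGeemen1994HodgeAV, Lemma 5.2 (6) and its proof (pp. 238–240), (5.4.1)] -/
theorem exists_betaInverse_of_weilBlock_oneEntry (t : ComplexPoints S) {q p' : ℕ} (hqp : q + 1 + p' = d)
    (φ : 𝒳 ⟶ 𝒳) (hφ : φ ≫ f = f) (φt : fiberOver f t ⟶ fiberOver f t) (hφt : φt ≫ fiberι f t = fiberι f t ≫ φ)
    {a b c : ℂ} (hab : a ≠ b) (hac : a ≠ c) (hbc : b ≠ c)
    {u : complexBetti 𝒳 (2 * q + 2)} {u' : complexBetti 𝒳 (2 * p')} (hu : u ∈ algebraicClasses 𝒳 (q + 1)) (hu' : u' ∈ algebraicClasses 𝒳 p')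
    (hu0 : 𝐣[t, 2 * q + 2] u ≠ 0)
    (hpair : traceC (hf.isSmoothProjective_fiberOver t)
      (cupProduct (show 2 * q + 2 + 2 * p' = 2 * d by omega) (𝐣[t, 2 * q + 2] u) (𝐣[t, 2 * p'] u')) ≠ 0)
    {xb xc : complexBetti (fiberOver f t) (2 * q + 2)}
    (hxa : (complexBetti.map φt (2 * q + 2)).hom (𝐣[t, 2 * q + 2] u) = a • 𝐣[t, 2 * q + 2] u)
    (hxb : (complexBetti.map φt (2 * q + 2)).hom xb = b • xb) (hxc : (complexBetti.map φt (2 * q + 2)).hom xc = c • xc)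
    (hspan : ∀ W, ∃ α β γ : ℂ, 𝐣[t, 2 * q + 2] W = α • 𝐣[t, 2 * q + 2] u + β • xb + γ • xc)
    (M : complexBetti 𝒳 (2 * q + 2 + 2) →ₗ[ℂ] complexBetti 𝒳 (2 * q + 2)) (algM : IsAlgebraicCorrespondence (d + 1) (d + 1) 𝒳 𝒳 M)
    (cj : complexBetti (fiberOver f t) (2 * q + 2) →ₛₗ[starRingEnd ℂ] complexBetti (fiberOver f t) (2 * q + 2)) (hcc : ∀ x, cj (cj x) = x)
    (hcT : ∀ x, cj ((complexBetti.map φt (2 * q + 2)).hom x) = (complexBetti.map φt (2 * q + 2)).hom (cj x))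
    (hcv : ∀ x, cj (𝐣[t, 2 * q + 2] (M (𝐆[hf, t, 2 * q + 2] x))) = 𝐣[t, 2 * q + 2] (M (𝐆[hf, t, 2 * q + 2] (cj x))))
    (ha : starRingEnd ℂ a = a) (hb : starRingEnd ℂ b = c) (hc : starRingEnd ℂ c = b) (hx : cj xb = xc)
    (hentry : (𝐋[(complexBetti.map φt (2 * q + 2)).hom ; b ; a, c]) (𝐣[t, 2 * q + 2] (M (𝐆[hf, t, 2 * q + 2] xc))) ≠ 0) :
    ∃ T : complexBetti 𝒳 (2 * q + 2 + 2) →ₗ[ℂ] complexBetti 𝒳 (2 * q + 2),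
      IsAlgebraicCorrespondence (d + 1) (d + 1) 𝒳 𝒳 T ∧
        ∀ W, 𝐣[t, 2 * q + 2] (T (𝐆[hf, t, 2 * q + 2] (𝐣[t, 2 * q + 2] W))) = 𝐣[t, 2 * q + 2] W := by
  refine exists_betaInverse_of_weilBlock_swap hf t hqp φ hφ φt hφt hab hac hbc hu hu' hu0 hpair hxa hxb hxc hspan M M algM algM hentry ?_
  -- the `(c,b)` entry is the conjugate of the `(b,c)` entry
  have h := lagrange_entry_conj_swap cj hcc (complexBetti.map φt (2 * q + 2)).hom (𝐣[t, 2 * q + 2] ∘ₗ M ∘ₗ 𝐆[hf, t, 2 * q + 2]) hcT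
    (fun x ↦ by simpa only [LinearMap.comp_apply] using hcv x) ha hb hc hx
  simp only [LinearMap.comp_apply] at h
  rw [h]
  intro h0
  apply hentry
  have h1 := congrArg cj h0
  rwa [hcc, map_zero] at h1

/-- **ONE NON-ZERO DIAGONAL WEIL ENTRY OF ONE REAL CYCLE SUFFICES**: same data; if the `(b,b)` entry `L_b (j_t^* M j_{t*} x_b)` is non-zero
then so is the `(c,c)` entry (its conjugate) and β holds at `t` in degree `2q+2` (part XLI-e's diagonal pattern with `M_b = M_c = M`).
[cite: Kleiman1968AlgebraicCycles, Appendix to §2, Thm. 2A11] [cite: VoisinHodgeI2002, §6.1.3 Cor. 6.12] [cite: vanGeemen1994HodgeAV, Lemma 5.2 (6) and its proof (pp. 238–240), (5.4.1)] -/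
theorem exists_betaInverse_of_weilBlock_oneEntry_diag (t : ComplexPoints S) {q p' : ℕ} (hqp : q + 1 + p' = d)
    (φ : 𝒳 ⟶ 𝒳) (hφ : φ ≫ f = f) (φt : fiberOver f t ⟶ fiberOver f t) (hφt : φt ≫ fiberι f t = fiberι f t ≫ φ)
    {a b c : ℂ} (hab : a ≠ b) (hac : a ≠ c) (hbc : b ≠ c)
    {u : complexBetti 𝒳 (2 * q + 2)} {u' : complexBetti 𝒳 (2 * p')} (hu : u ∈ algebraicClasses 𝒳 (q + 1)) (hu' : u' ∈ algebraicClasses 𝒳 p')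
    (hu0 : 𝐣[t, 2 * q + 2] u ≠ 0)
    (hpair : traceC (hf.isSmoothProjective_fiberOver t)
      (cupProduct (show 2 * q + 2 + 2 * p' = 2 * d by omega) (𝐣[t, 2 * q + 2] u) (𝐣[t, 2 * p'] u')) ≠ 0)
    {xb xc : complexBetti (fiberOver f t) (2 * q + 2)}
    (hxa : (complexBetti.map φt (2 * q + 2)).hom (𝐣[t, 2 * q + 2] u) = a • 𝐣[t, 2 * q + 2] u)
    (hxb : (complexBetti.map φt (2 * q + 2)).hom xb = b • xb) (hxc : (complexBetti.map φt (2 * q + 2)).hom xc = c • xc)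
    (hspan : ∀ W, ∃ α β γ : ℂ, 𝐣[t, 2 * q + 2] W = α • 𝐣[t, 2 * q + 2] u + β • xb + γ • xc)
    (M : complexBetti 𝒳 (2 * q + 2 + 2) →ₗ[ℂ] complexBetti 𝒳 (2 * q + 2)) (algM : IsAlgebraicCorrespondence (d + 1) (d + 1) 𝒳 𝒳 M)
    (cj : complexBetti (fiberOver f t) (2 * q + 2) →ₛₗ[starRingEnd ℂ] complexBetti (fiberOver f t) (2 * q + 2)) (hcc : ∀ x, cj (cj x) = x)
    (hcT : ∀ x, cj ((complexBetti.map φt (2 * q + 2)).hom x) = (complexBetti.map φt (2 * q + 2)).hom (cj x))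
    (hcv : ∀ x, cj (𝐣[t, 2 * q + 2] (M (𝐆[hf, t, 2 * q + 2] x))) = 𝐣[t, 2 * q + 2] (M (𝐆[hf, t, 2 * q + 2] (cj x))))
    (ha : starRingEnd ℂ a = a) (hb : starRingEnd ℂ b = c) (hc : starRingEnd ℂ c = b) (hx : cj xb = xc)
    (hentry : (𝐋[(complexBetti.map φt (2 * q + 2)).hom ; b ; a, c]) (𝐣[t, 2 * q + 2] (M (𝐆[hf, t, 2 * q + 2] xb))) ≠ 0) :
    ∃ T : complexBetti 𝒳 (2 * q + 2 + 2) →ₗ[ℂ] complexBetti 𝒳 (2 * q + 2),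
      IsAlgebraicCorrespondence (d + 1) (d + 1) 𝒳 𝒳 T ∧
        ∀ W, 𝐣[t, 2 * q + 2] (T (𝐆[hf, t, 2 * q + 2] (𝐣[t, 2 * q + 2] W))) = 𝐣[t, 2 * q + 2] W := by
  refine exists_betaInverse_of_weilBlock_diag hf t hqp φ hφ φt hφt hab hac hbc hu hu' hu0 hpair hxa hxb hxc hspan M M algM algM hentry ?_
  have h := lagrange_entry_conj_diag cj (complexBetti.map φt (2 * q + 2)).hom (𝐣[t, 2 * q + 2] ∘ₗ M ∘ₗ 𝐆[hf, t, 2 * q + 2]) hcT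
    (fun x ↦ by simpa only [LinearMap.comp_apply] using hcv x) ha hb hc hx
  simp only [LinearMap.comp_apply] at h
  rw [h]
  intro h0
  apply hentry
  have h1 := congrArg cj h0
  rwa [hcc, map_zero] at h1

end OneEntry

end Summit.HodgeConjecture.HodgeConjecture.Ring2.AbelianAll

end
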